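import Summits.Ventures.YMGap.YM3IR.ReceiverWitness
import Summits.Ventures.YMGap.RobustBall.TorusRowsSU2StarW
import Summits.Ventures.YMGap.RobustBall.PlaquetteMember
import Summits.Ventures.YMGap.RobustBall.BallClosureTorus
import Summits.Ventures.YMGap.RobustBall.RobustAreaLawVertexW
import Literature.MathematicalPhysics.QuantumFieldTheory.BlockScaleEffectivePerturbation
import HarnessLib


/-!
# YM4Door / StripDoor — the STRIP DOOR of the `d = 4` strong-coupling bridge: Bałaban's format (ii)+(iv) on the strip ⇒
# track Y2's tier-2 ball; every certified `SU(2)` cell in Bałaban's currency; the Wilson-priced Haar basin; H-b′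

HONEST FRAMING (cell `ym-beyond`, seat P2 «strong-coupling bridge», HUMAN RULING D-0035 / D-0037; tree edition, g8,
2026-08-25, of the farm-checked HOME sketch `HOME/ROUTE-P2-SketchOpen.lean` v0.6 sha16 44ea1120d7666484 §0–§8 — namespace
`YMBeyond.P2.Strip` → `Summit.Ventures.YMGap.YM4Door`; memo `HOME/ROUTE-P2.md` §4d–§4e; referee baseline v0.7 PASS).
LATTICE / finite-torus bookkeeping only: nothing here is a continuum, spectral or Clay-sense statement; nothing here
moves the weak-coupling exit `β_exit` of Track A (uncertified); nothing here is a part of Bałaban's theorems and NO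
membership of any renormalisation-group output in any ball is asserted — the hypotheses `InFormat`/`HasAnalyticNormLE`
below are exactly the printed format (ii)+(iv) of T. Bałaban, CMP 119 (1988) p. 259, typed by the Literature module
`BlockScaleEffectivePerturbation` as HYPOTHESES.  Every non-trivial analytic step is a TREE theorem used BY NAME (cell
`pub-ymgap`: the Cauchy–Schwarz receiver `YM3IR/ReceiverWitness.lean`; track Y2's certified `SU(2)`, `d = 4` tier-2 rows
`RobustBall/TorusRowsSU2StarW.lean`; additivity of loads `RobustBall/BallClosureTorus.lean`; the plaquette member
`RobustBall/PlaquetteMember.lean`).  This file contains NO conjecture name, NO `sorry`, NO axiom beyond the standard three,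
and defines nothing under `RobustBall/` or `Literature/`.  A typed DICTIONARY «Bałaban's last-scale currency ↦ the
strong-coupling receiver's load currency» with the numbers kernel-checked; label K = kernel bookkeeping throughout.

* §0–§1 helpers (`self_le_exp_div`: `t ≤ e^{δt}/(eδ)`; `clusterDomain_mono_radii`; `ball_subset_stripDomain`: the complex
  `r`-ball around a real configuration lies in the strip of width `r`).
* §2 THE STRIP DOOR, two-sum form: analyticity on the strip with explicit majorants `M_X` ⇒ `ClusterDomain` membership
  (`mem_clusterDomain_of_analyticOnStrip`, = receiver (E1) fed by the strip).
* §3 THE STRIP DOOR IN BAŁABAN'S (2.42) NORM: ONE number `η` at rate `κ` — `HasAnalyticNormLE r κ η` on thin supports with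
  `κ ≥ κ_b + δ` ⇒ `W ∈ ClusterDomain κ_b (2η) (8η/(eδr))` (`mem_clusterDomain_of_hasAnalyticNormLE_strip`; the first moment
  of the support size is paid by the rate surplus `δ` through §0); `inBall_of_inFormat_strip`.
* §4 THE NUMBERS, `SU(2)`, `d = 4`: strip format ⇒ clustering at track Y2's certified rows `β_W,eff ≤ 1/8, 1/3, 1/6`
  (`su2_clustersWith_of_strip_*`), §4b the HAAR BASIN (tree coupling `0`, any oscillation load, Lipschitz load `1/3`;
  `su2_torusClusteringOnBallW_star_haar_t100`, `su2_clustersWith_of_strip_haar`).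
* §5 H-b′ for Track A: the door as a menu of cells `DoorCell β₀ ε₀ ε₁` (`doorCell_*`), Bałaban's strip format at a cell
  `SU2.InStripFormat`, block-level clustering `SU2.BlockClusters` and «Gibbs form at the strip door ⇒ BlockClusters»
  (`SU2.blockClusters_of_gibbsFormAtStripDoor`, rows `_oneEighth/_oneThird/_haar`).  §6 non-vacuity: the pure Wilson action
  is at the strip door (`inStripFormat_wilsonAt`, `clustersWith_wilson_oneEighth`).
* §7 THE COMPLETE STRIP TABLE: the remaining tree cells `1/5, 1/4, 3/10` and the two generated cells `(1/10; 3/10, 17/100)`,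
  `(1/20; 3/10, 1/4)` through ONE generic consumer `su2_clustersWith_of_strip_cell` (cell `(β₀; ε₀, ε₁)` is fed by strip
  format `(r, κ, η)` iff `η ≤ ε₀/2 ∧ η ≤ ε₁·e·δ·r/8`); block level `SU2.blockClusters_of_stripDoor_*`.
* §8 THE BASIN IN BAŁABAN'S CURRENCY: the certified Wilson price (`WilsonPrice.*`: the Wilson plaquette term is a ball member
  with oscillation `2|β|·2√2·‖·‖` and Lipschitz loads kernel-computed), `SU2.inBall_relabel`, `SU2.law_relabel`,
  `SU2.clustersWith_of_smallWilson`; strip format `(r, κ, η)`, thin supports, `κ ≥ 1/100 + δ` and the ONE inequality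
  `8η/(eδr) + e^{1/100}·72√2·|β| ≤ 1/3` ⇒ clustering at `(16 e^{1/50}, 1/100)`, either sign of the effective coupling
  (`SU2.clustersWith_of_strip_smallWilson`, numeric row `SU2.clustersWith_of_strip_milli`); H-b″
  `SU2.GibbsFormAtStripBasin ⇒ BlockClusters` and `gibbsFormAtStripBasin_of_haarDoor`.

NOT HERE: the OPEN DOOR / U-CV / the crossover operator (`YM4Door/OpenDoor.lean`); observable transport through the block
map (`YM4Door/BlockTransport.lean`); the Haar form of a blocked Gibbs density and the door-condition glue `AtDoorCell/AtBasin`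
(`YM4Door/HaarForm.lean`); the Y2 bridge (summit side, crux `OSLegsAtWeakCouplingC`).  THE NUMBER (memo §2): the certified
door is `β_W,eff ≤ 1/3` (`g² ≥ 12`) against an uncertified weak-coupling exit `γ₀ ≈ 0.55` (`β_W ≈ 13`) — two Bałaban-(2.42)
units apart in coupling, NOT closed by anything in this file.

References: T. Bałaban, CMP 119 (1988) 243–285, p. 259 (ii),(iv), p. 261 (2.39),(2.42) [Balaban1988Convergent]; CMP 122
(1989) 355–392 [Balaban1989LargeFieldII]; H. Föllmer, LNM 1362 (1988) Ch. I; R. L. Dobrushin, Theory Probab. Appl. 13 (1968);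
the tree files named above.

THIS MODULE: §0–§4 (helpers, strip geometry, the strip door in two-sum and (2.42) form, the `SU(2)` numbers);
§5–§7 are `YM4Door/StripCells.lean`, §8 is `YM4Door/WilsonPrice.lean` (split for the gate's 400-line limit; one text, g8).
-/

noncomputable section

open MeasureTheory Finset Function Metric
open scoped Matrix.Norms.Frobenius
open Literature.Probability.LatticeModels Literature.Probability.LatticeModels.DobrushinMetric
open Literature.MathematicalPhysics.QuantumLattice hiding torusNorm configShift
open Literature.MathematicalPhysics.QuantumFieldTheory hiding ZdEdge
open Summit.Ventures.YMGap.RobustBall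
open Summit.Ventures.YMGap.StarResolventDim (Delta gaugeR doorPoly)
open Summit.Ventures.YMGap.YM3IR.ReceiverWitness

namespace Summit.Ventures.YMGap.YM4Door

variable {d L N : ℕ} [NeZero L]

/-! ## §0  Two real-variable helpers -/

/-- `t ≤ e^{δt}/(eδ)` for `δ > 0` (all real `t`): the first moment costs one unit of rate. -/
theorem self_le_exp_div {δ : ℝ} (hδ : 0 < δ) (t : ℝ) : t ≤ Real.exp (δ * t) / (Real.exp 1 * δ) := by
  have h := Real.add_one_le_exp (δ * t - 1)
  rw [sub_add_cancel, Real.exp_sub] at h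
  have h' : δ * t * Real.exp 1 ≤ Real.exp (δ * t) := (le_div_iff₀ (Real.exp_pos 1)).1 h
  rw [le_div_iff₀ (by positivity)]
  calc t * (Real.exp 1 * δ) = δ * t * Real.exp 1 := by ring
    _ ≤ Real.exp (δ * t) := h'

/-- The tier-2 ball is monotone in its two radii (the tree's `clusterDomain_mono`, radii part, re-proved to keep imports small). -/
theorem clusterDomain_mono_radii {κ ε₀ ε₁ ε₀' ε₁' : ℝ} (h₀ : ε₀ ≤ ε₀') (h₁ : ε₁ ≤ ε₁') {W : Perturbation d L N}
    (hW : W ∈ ClusterDomain (d := d) (L := L) (N := N) κ ε₀ ε₁) : W ∈ ClusterDomain (d := d) (L := L) (N := N) κ ε₀' ε₁' := by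
  obtain ⟨w, hw₀, hw₁⟩ := hW
  exact ⟨w, fun e => (hw₀ e).trans h₀, fun e => (hw₁ e).trans h₁⟩

/-! ## §1  Strip geometry: the `r`-ball around every real configuration lies in the strip of width `r` -/

/-- (E1) of the receiver holds for the STRIP: `ball (ρ ∘ U) r ⊆ stripDomain ρ r` for every real `U`. -/
theorem ball_subset_stripDomain {G : Type*} [Group G] (ρ : G →* Matrix (Fin N) (Fin N) ℂ) (r : ℝ)
    (U : GaugeConfig d L G) : ball (complexify ρ U) r ⊆ stripDomain (d := d) (L := L) ρ r :=
  Metric.ball_subset_thickening (Set.mem_range_self U) r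

/-- Every site is a block corner at block scale `1`. -/
theorem mem_blockCorners_one (y : Site d L) : y ∈ blockCorners (d := d) (L := L) 1 :=
  mem_image.2 ⟨y, mem_univ _, blockCorner_one y⟩

/-! ## §2  The strip door, two-sum form (majorants `M_X` explicit) -/

/-- **STRIP DOOR, two-sum form.**  Activities analytic on the strip of width `r > 0` (defining representation) with
bounds `M_X`, thin supports `diam X ≤ |X| − 1` wherever `M_X ≠ 0`, rates `0 ≤ κ_b ≤ κ_s`, and the two weighted sums
`∑_{X ∋ y} M_X e^{κ_s|X|} ≤ η`, `∑_{X ∋ y} M_X |X| e^{κ_s|X|} ≤ η₁` ⇒ `W ∈ ClusterDomain κ_b (2e^{−κ_b}η) ((2d/r)e^{−κ_b}η₁)`.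
One line over the tree's receiver `mem_clusterDomain_of_analytic_affineDiam` (`s X = |X|`, `a = −1`). -/
theorem mem_clusterDomain_of_analyticOnStrip (W : Perturbation d L N) {M : Finset (Site d L) → ℝ} {r : ℝ}
    (hr : 0 < r)
    (hA : W.IsAnalyticOn (fundamentalRep (Fin N)) (fun _ => stripDomain (fundamentalRep (Fin N)) r) M)
    (hsupp : ∀ X, M X ≠ 0 → (polymerDiam X : ℝ) ≤ (X.card : ℝ) - 1)
    {κb κs η η₁ : ℝ} (hκb : 0 ≤ κb) (hκs : κb ≤ κs)
    (hη : ∀ y : Site d L, ∑ X ∈ polymersThrough (d := d) (L := L) 1 y, M X * Real.exp (κs * (X.card : ℝ)) ≤ η)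
    (hη₁ : ∀ y : Site d L, ∑ X ∈ polymersThrough (d := d) (L := L) 1 y,
      M X * X.card * Real.exp (κs * (X.card : ℝ)) ≤ η₁) :
    W ∈ ClusterDomain (d := d) (L := L) (N := N) κb (2 * (Real.exp (-κb) * η))
      (2 * d / r * (Real.exp (-κb) * η₁)) := by
  have h := mem_clusterDomain_of_analytic_affineDiam W (fundamentalRep (Fin N))
    (fun a b => (dist_fundamentalRep_eq a b).le) hr hA (fun X U => ball_subset_stripDomain _ r U) hκb hκs
    (s := fun X => (X.card : ℝ)) (a := -1) (fun X => Nat.cast_nonneg _)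
    (fun X hX => by simpa [sub_eq_add_neg] using hsupp X hX) hη hη₁
  rwa [mul_neg_one] at h

/-! ## §3  The strip door in Bałaban's (2.42) norm: ONE number `η` at rate `κ` -/

section Trim

variable {G : Type*} [Group G] [MeasurableSpace G]

open Classical in
/-- The majorant trimmed to the support of `W` (`0` where `W_X ≡ 0`). -/
def trim (W : QuasiLocalGaugePerturbation d L G 1) (M : Finset (Site d L) → ℝ) (X : Finset (Site d L)) : ℝ :=
  if W.act X = 0 then 0 else M X

variable {W : QuasiLocalGaugePerturbation d L G 1} {M : Finset (Site d L) → ℝ} {X : Finset (Site d L)}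

/-- The trimmed majorant vanishes where the term vanishes. -/
theorem trim_of_eq (h : W.act X = 0) : trim W M X = 0 := by simp [trim, h]

/-- The trimmed majorant is `M X` where the term is non-zero. -/
theorem trim_of_ne (h : W.act X ≠ 0) : trim W M X = M X := by simp [trim, h]

/-- A non-zero trimmed majorant detects a non-zero term. -/
theorem trim_ne_zero (h : trim W M X ≠ 0) : W.act X ≠ 0 := fun h0 => h (trim_of_eq h0)

/-- The trimmed majorant is at most the majorant. -/
theorem trim_le (hM : 0 ≤ M X) : trim W M X ≤ M X := by
  by_cases h : W.act X = 0
  · rw [trim_of_eq h]; exact hM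
  · rw [trim_of_ne h]

/-- The trimmed majorant is nonnegative. -/
theorem trim_nonneg (hM : 0 ≤ M X) : 0 ≤ trim W M X := by
  by_cases h : W.act X = 0
  · rw [trim_of_eq h]
  · rw [trim_of_ne h]; exact hM

/-- Analyticity data survive trimming: where `W_X ≡ 0` the zero function is an analytic extension with bound `0`. -/
theorem isAnalyticOn_trim {ρ : G →* Matrix (Fin N) (Fin N) ℂ} {D : Finset (Site d L) → Set (ComplexGaugeConfig d L N)}
    (hA : W.IsAnalyticOn ρ D M) : W.IsAnalyticOn ρ D (trim W M) := by
  intro X hX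
  by_cases h0 : W.act X = 0
  · refine ⟨0, differentiableOn_const 0, fun U _ => ?_, fun Z _ => ?_⟩
    · simp [h0]
    · simp [trim_of_eq h0]
  · obtain ⟨F, hF, hFW, hFM⟩ := hA X hX
    exact ⟨F, hF, hFW, fun Z hZ => by rw [trim_of_ne h0]; exact hFM Z hZ⟩

end Trim

/-- ★ **STRIP DOOR in Bałaban's currency.**  `W` in format (ii)+(iv) ON THE STRIP of width `r > 0` — analytic weighted norm
`‖W‖_{κ, strip r} ≤ η` in the sense of the tree's `HasAnalyticNormLE` (Bałaban CMP 119 (1988) p. 261 (2.42) with the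
small-field domains replaced by the uniform strip) — with thin supports (`diam X ≤ |X| − 1` wherever `W_X ≠ 0`), and a rate
margin `κ ≥ κ_b + δ`, `δ > 0`, `κ_b ≥ 0` ⇒ `W ∈ ClusterDomain κ_b (2η) (2d·η/(e·δ·r))`: oscillation load `2η` flat, Lipschitz
load `η/r` up to the factor `2d/(eδ)` (first moment `|X| ≤ e^{δ|X|}/(eδ)`). -/
theorem mem_clusterDomain_of_hasAnalyticNormLE_strip (W : Perturbation d L N) {r κ η κb δ : ℝ} (hr : 0 < r)
    (hW : W.HasAnalyticNormLE (fundamentalRep (Fin N)) (fun _ => stripDomain (fundamentalRep (Fin N)) r) κ η)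
    (hsupp : ∀ X, W.act X ≠ 0 → (polymerDiam X : ℝ) ≤ (X.card : ℝ) - 1)
    (hκb : 0 ≤ κb) (hδ : 0 < δ) (hκ : κb + δ ≤ κ) :
    W ∈ ClusterDomain (d := d) (L := L) (N := N) κb (2 * η) (2 * d / (Real.exp 1 * δ * r) * η) := by
  classical
  obtain ⟨M, hA, hM⟩ := hW
  have hM0 : ∀ X, 0 ≤ M X := fun X => by
    obtain ⟨F, -, -, hFM⟩ := hA X (mem_polymers_one X)
    exact (norm_nonneg _).trans (hFM _ (complexify_mem_stripDomain (fundamentalRep (Fin N)) hr 1))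
  have hη0 : 0 ≤ η := le_trans (sum_nonneg fun X _ => mul_nonneg (hM0 X) (Real.exp_pos _).le)
    (hM 0 (zero_mem_blockCorners 1))
  have hA' : W.IsAnalyticOn (fundamentalRep (Fin N)) (fun _ => stripDomain (fundamentalRep (Fin N)) r) (trim W M) :=
    isAnalyticOn_trim hA
  -- the two sums at rate `κb`, from the one sum at rate `κ ≥ κb + δ`
  have hsum : ∀ y : Site d L, ∑ X ∈ polymersThrough (d := d) (L := L) 1 y,
      trim W M X * Real.exp (κb * (X.card : ℝ)) ≤ η := by
    intro y
    refine le_trans (sum_le_sum fun X _ => ?_) (hM y (mem_blockCorners_one y))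
    exact mul_le_mul (trim_le (hM0 X)) (Real.exp_le_exp.2
      (mul_le_mul_of_nonneg_right (by linarith) (Nat.cast_nonneg _))) (Real.exp_pos _).le (hM0 X)
  have hsum₁ : ∀ y : Site d L, ∑ X ∈ polymersThrough (d := d) (L := L) 1 y,
      trim W M X * X.card * Real.exp (κb * (X.card : ℝ)) ≤ η / (Real.exp 1 * δ) := by
    intro y
    have key : ∀ X : Finset (Site d L), trim W M X * X.card * Real.exp (κb * (X.card : ℝ)) ≤
        M X * Real.exp (κ * (X.card : ℝ)) / (Real.exp 1 * δ) := by
      intro X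
      have h1 : trim W M X ≤ M X := trim_le (hM0 X)
      have h2 : (X.card : ℝ) ≤ Real.exp (δ * X.card) / (Real.exp 1 * δ) := self_le_exp_div hδ _
      have h3 : Real.exp (κb * (X.card : ℝ)) * Real.exp (δ * X.card) ≤ Real.exp (κ * (X.card : ℝ)) := by
        rw [← Real.exp_add]
        exact Real.exp_le_exp.2 (by nlinarith [Nat.cast_nonneg (α := ℝ) X.card])
      calc trim W M X * X.card * Real.exp (κb * (X.card : ℝ))
          ≤ M X * (Real.exp (δ * X.card) / (Real.exp 1 * δ)) * Real.exp (κb * (X.card : ℝ)) :=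
            mul_le_mul_of_nonneg_right (mul_le_mul h1 h2 (Nat.cast_nonneg _) (hM0 X)) (Real.exp_pos _).le
        _ = M X * (Real.exp (κb * (X.card : ℝ)) * Real.exp (δ * X.card)) / (Real.exp 1 * δ) := by ring
        _ ≤ M X * Real.exp (κ * (X.card : ℝ)) / (Real.exp 1 * δ) :=
            div_le_div_of_nonneg_right (mul_le_mul_of_nonneg_left h3 (hM0 X)) (by positivity)
    calc ∑ X ∈ polymersThrough (d := d) (L := L) 1 y, trim W M X * X.card * Real.exp (κb * (X.card : ℝ))
        ≤ ∑ X ∈ polymersThrough (d := d) (L := L) 1 y, M X * Real.exp (κ * (X.card : ℝ)) / (Real.exp 1 * δ) :=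
          sum_le_sum fun X _ => key X
      _ = (∑ X ∈ polymersThrough (d := d) (L := L) 1 y, M X * Real.exp (κ * (X.card : ℝ))) / (Real.exp 1 * δ) := by
          rw [Finset.sum_div]
      _ ≤ η / (Real.exp 1 * δ) := div_le_div_of_nonneg_right (hM y (mem_blockCorners_one y)) (by positivity)
  have h := mem_clusterDomain_of_analyticOnStrip W hr hA' (fun X hX => hsupp X (trim_ne_zero hX)) hκb le_rfl hsum hsum₁
  have hexp : Real.exp (-κb) ≤ 1 := Real.exp_le_one_iff.2 (by linarith)
  refine clusterDomain_mono_radii ?_ ?_ h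
  · calc 2 * (Real.exp (-κb) * η) ≤ 2 * (1 * η) := by gcongr
      _ = 2 * η := by ring
  · have hq : 0 ≤ η / (Real.exp 1 * δ) := by positivity
    calc 2 * (d : ℝ) / r * (Real.exp (-κb) * (η / (Real.exp 1 * δ)))
        ≤ 2 * (d : ℝ) / r * (1 * (η / (Real.exp 1 * δ))) := by gcongr
      _ = 2 * d / (Real.exp 1 * δ * r) * η := by
          field_simp

/-- ★ **`InFormat` ON THE STRIP ⇒ `InBall`** for a Bałaban effective action (any `d`, `N`, block lattice `S`): format constants
`(κ, B₀, C₀)` on the strip of width `r`, thin supports, `κ ≥ κ_b + δ` ⇒ `InBall κ_b (2B₀) (2d·B₀/(eδr)) 𝓔.terms`.  The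
large-field floor `C₀` is not used: on the strip there is no large-field region left to floor. -/
theorem inBall_of_inFormat_strip {S : ℕ} [NeZero S] (𝓔 : BalabanEffectiveAction d S (SUN N) 1) {r κ B₀ C₀ κb δ : ℝ}
    (hr : 0 < r) (h : 𝓔.InFormat (fundamentalRep (Fin N)) (fun _ => stripDomain (fundamentalRep (Fin N)) r) κ B₀ C₀)
    (hsupp : ∀ X, 𝓔.terms.act X ≠ 0 → (polymerDiam X : ℝ) ≤ (X.card : ℝ) - 1)
    (hκb : 0 ≤ κb) (hδ : 0 < δ) (hκ : κb + δ ≤ κ) :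
    InBall κb (2 * B₀) (2 * d / (Real.exp 1 * δ * r) * B₀) 𝓔.terms :=
  mem_clusterDomain_of_hasAnalyticNormLE_strip 𝓔.terms hr h.1 hsupp hκb hδ hκ

/-- On a strip of positive width the (2.42)-norm bound is nonnegative (the majorants dominate `‖F_X‖ ≥ 0` at a real point). -/
theorem eta_nonneg_of_hasAnalyticNormLE_strip (W : Perturbation d L N) {r κ η : ℝ} (hr : 0 < r)
    (hW : W.HasAnalyticNormLE (fundamentalRep (Fin N)) (fun _ => stripDomain (fundamentalRep (Fin N)) r) κ η) : 0 ≤ η := by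
  obtain ⟨M, hA, hM⟩ := hW
  have hM0 : ∀ X, 0 ≤ M X := fun X => by
    obtain ⟨F, -, -, hFM⟩ := hA X (mem_polymers_one X)
    exact (norm_nonneg _).trans (hFM _ (complexify_mem_stripDomain (fundamentalRep (Fin N)) hr 1))
  exact le_trans (sum_nonneg fun X _ => mul_nonneg (hM0 X) (Real.exp_pos _).le) (hM 0 (zero_mem_blockCorners 1))

/-! ## §4  The numbers: `SU(2)`, `d = 4`, through track Y2's certified tier-2 rows -/

/-- **General consumer**: any certified tier-2 row `TorusClusteringOnBallW N d β κ_b ε₀ ε₁ A m` is fed by the strip format as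
soon as `2η ≤ ε₀` and `2d·η/(eδr) ≤ ε₁`. -/
theorem clustersWith_of_strip {β κb ε₀ ε₁ A m : ℝ} (hT : TorusClusteringOnBallW N d β κb ε₀ ε₁ A m) (hL : 3 ≤ L)
    (W : Perturbation d L N) {r κ η δ : ℝ} (hr : 0 < r)
    (hW : W.HasAnalyticNormLE (fundamentalRep (Fin N)) (fun _ => stripDomain (fundamentalRep (Fin N)) r) κ η)
    (hsupp : ∀ X, W.act X ≠ 0 → (polymerDiam X : ℝ) ≤ (X.card : ℝ) - 1)
    (hκb : 0 ≤ κb) (hδ : 0 < δ) (hκ : κb + δ ≤ κ) (h₀ : 2 * η ≤ ε₀) (h₁ : 2 * d / (Real.exp 1 * δ * r) * η ≤ ε₁) :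
    ClustersWith W β A m :=
  hT L hL W (clusterDomain_mono_radii h₀ h₁ (mem_clusterDomain_of_hasAnalyticNormLE_strip W hr hW hsupp hκb hδ hκ))

/-- **ROW `β_W,eff ≤ 1/8` IN BAŁABAN'S CURRENCY** (`SU(2)`, `d = 4`, tree `β ≤ 1/16`, loads `(73/250, 73/500)`): strip width
`r`, rate `κ ≥ 1/100 + δ`, norm `η` with `2η ≤ 73/250` and `8η/(eδr) ≤ 73/500` ⇒ clustering at `(16 e^{1/50}, 1/100)` on every
torus `L ≥ 3`.  HYPOTHESIS-FREE beyond the format hypotheses on `W`. -/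
theorem su2_clustersWith_of_strip_oneEighth (hL : 3 ≤ L) (W : Perturbation 4 L 2) {r κ η δ β : ℝ} (hr : 0 < r)
    (hW : W.HasAnalyticNormLE (fundamentalRep (Fin 2)) (fun _ => stripDomain (fundamentalRep (Fin 2)) r) κ η)
    (hsupp : ∀ X, W.act X ≠ 0 → (polymerDiam X : ℝ) ≤ (X.card : ℝ) - 1)
    (hδ : 0 < δ) (hκ : 1 / 100 + δ ≤ κ) (h₀ : 2 * η ≤ 73 / 250) (h₁ : 8 / (Real.exp 1 * δ * r) * η ≤ 73 / 500)
    (hβ0 : 0 ≤ β) (hβ : β ≤ 1 / 16) : ClustersWith W β (16 * Real.exp (1 / 50)) (1 / 100) := by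
  have h₁' : 2 * ((4 : ℕ) : ℝ) / (Real.exp 1 * δ * r) * η ≤ 73 / 500 := by
    have e : (2 : ℝ) * ((4 : ℕ) : ℝ) = 8 := by norm_num
    rw [e]; exact h₁
  exact clustersWith_of_strip (su2_torusClusteringOnBallW_star_oneEighth_t100 (1 / 100) le_rfl β hβ0 hβ) hL W hr hW
    hsupp (by norm_num) hδ hκ h₀ h₁'

/-- **ROW `β_W,eff ≤ 1/3` IN BAŁABAN'S CURRENCY** (`SU(2)`, `d = 4`, tree `β ≤ 1/6`, loads `(11/500, 11/1000)`): strip width `r`,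
rate `κ ≥ 1/100 + δ`, norm `η` with `2η ≤ 11/500` and `8η/(eδr) ≤ 11/1000` ⇒ clustering at `(16 e^{1/50}, 1/100)`. -/
theorem su2_clustersWith_of_strip_oneThird (hL : 3 ≤ L) (W : Perturbation 4 L 2) {r κ η δ β : ℝ} (hr : 0 < r)
    (hW : W.HasAnalyticNormLE (fundamentalRep (Fin 2)) (fun _ => stripDomain (fundamentalRep (Fin 2)) r) κ η)
    (hsupp : ∀ X, W.act X ≠ 0 → (polymerDiam X : ℝ) ≤ (X.card : ℝ) - 1)
    (hδ : 0 < δ) (hκ : 1 / 100 + δ ≤ κ) (h₀ : 2 * η ≤ 11 / 500) (h₁ : 8 / (Real.exp 1 * δ * r) * η ≤ 11 / 1000)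
    (hβ0 : 0 ≤ β) (hβ : β ≤ 1 / 6) : ClustersWith W β (16 * Real.exp (1 / 50)) (1 / 100) := by
  have h₁' : 2 * ((4 : ℕ) : ℝ) / (Real.exp 1 * δ * r) * η ≤ 11 / 1000 := by
    have e : (2 : ℝ) * ((4 : ℕ) : ℝ) = 8 := by norm_num
    rw [e]; exact h₁
  exact clustersWith_of_strip (su2_torusClusteringOnBallW_star_oneThird_t100 (1 / 100) le_rfl β hβ0 hβ) hL W hr hW
    hsupp (by norm_num) hδ hκ h₀ h₁'

/-- **ROW `β_W,eff ≤ 1/6` IN BAŁABAN'S CURRENCY** (`SU(2)`, `d = 4`, tree `β ≤ 1/12`, loads `(11/50, 11/100)`): `2η ≤ 11/50` and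
`8η/(eδr) ≤ 11/100` ⇒ clustering at `(16 e^{1/50}, 1/100)`. -/
theorem su2_clustersWith_of_strip_oneSixth (hL : 3 ≤ L) (W : Perturbation 4 L 2) {r κ η δ β : ℝ} (hr : 0 < r)
    (hW : W.HasAnalyticNormLE (fundamentalRep (Fin 2)) (fun _ => stripDomain (fundamentalRep (Fin 2)) r) κ η)
    (hsupp : ∀ X, W.act X ≠ 0 → (polymerDiam X : ℝ) ≤ (X.card : ℝ) - 1)
    (hδ : 0 < δ) (hκ : 1 / 100 + δ ≤ κ) (h₀ : 2 * η ≤ 11 / 50) (h₁ : 8 / (Real.exp 1 * δ * r) * η ≤ 11 / 100)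
    (hβ0 : 0 ≤ β) (hβ : β ≤ 1 / 12) : ClustersWith W β (16 * Real.exp (1 / 50)) (1 / 100) := by
  have h₁' : 2 * ((4 : ℕ) : ℝ) / (Real.exp 1 * δ * r) * η ≤ 11 / 100 := by
    have e : (2 : ℝ) * ((4 : ℕ) : ℝ) = 8 := by norm_num
    rw [e]; exact h₁
  exact clustersWith_of_strip (su2_torusClusteringOnBallW_star_oneSixth_t100 (1 / 100) le_rfl β hβ0 hβ) hL W hr hW
    hsupp (by norm_num) hδ hκ h₀ h₁'

/-! ### §4b  The Haar basin (seat P2 g4's cell, first certified in HOME `ROUTE-P2-SketchDoor.lean` §1) and its strip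
form: at effective coupling `0` the strip door is ONE inequality -/

/-- g4's **HAAR-BASIN CELL with a sliver of coupling** (verbatim): `SU(2)`, `d = 4`; every `κ ≥ 1/100`, every oscillation budget
`ε₀ ≥ 0`, every tree coupling `0 ≤ β ≤ (1/500)/(e^{ε₀}(1 + 2·1.41422/3))`: every member of `ClusterDomain κ ε₀ (1/3)` clusters at
`(16 e^{1/50}, 1/100)` on every torus `L ≥ 3`.  Certificate `c = 1/1000`, `λ = 4715/10000`, `K = 20`.  HYPOTHESIS-FREE. -/
theorem su2_torusClusteringOnBallW_star_haarSliver_t100 :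
    ∀ κ : ℝ, 1 / 100 ≤ κ → ∀ ε₀ : ℝ, 0 ≤ ε₀ → ∀ β : ℝ, 0 ≤ β →
      β ≤ (1 / 500) / (Real.exp ε₀ * (1 + 2 * (1.41422 : ℝ) * (1 / 3))) →
      TorusClusteringOnBallW 2 4 β κ ε₀ (1 / 3) (16 * Real.exp (1 / 50)) (1 / 100) := by
  intro κ hκ ε₀ hε₀ β hβ0' hβle
  have hD1 : (1 : ℝ) ≤ 1 + 2 * (1.41422 : ℝ) * (1 / 3) := by norm_num
  have hE1 : 1 ≤ Real.exp ε₀ := Real.one_le_exp hε₀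
  have hED : 1 ≤ Real.exp ε₀ * (1 + 2 * (1.41422 : ℝ) * (1 / 3)) := one_le_mul_of_one_le_of_one_le hE1 hD1
  obtain ⟨βW, hβW⟩ : ∃ x : ℝ, x = 4 * (1 / 1000) / (Real.exp ε₀ * (1 + 2 * (1.41422 : ℝ) * (1 / 3))) := ⟨_, rfl⟩
  have hβ0 : 0 < βW := by rw [hβW]; positivity
  have hβ : βW ≤ 2 / 3 := by
    rw [hβW]
    calc 4 * (1 / 1000) / (Real.exp ε₀ * (1 + 2 * (1.41422 : ℝ) * (1 / 3)))
        ≤ 4 * (1 / 1000) / 1 := div_le_div_of_nonneg_left (by norm_num) one_pos hED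
      _ ≤ 2 / 3 := by norm_num
  have hc : Real.exp ε₀ * (1 + 2 * (1.41422 : ℝ) * (1 / 3)) * (βW / 4) ≤ 1 / 1000 := by
    have : Real.exp ε₀ * (1 + 2 * (1.41422 : ℝ) * (1 / 3)) * (βW / 4) = 1 / 1000 := by
      rw [hβW]; field_simp
    exact this.le
  have h := su2_torusClusteringOnBallW_star 20 (βW := βW) (κ := κ) (ε₀ := ε₀) (ε₁ := 1 / 3)
    (c := 1 / 1000) (lam := 4715 / 10000) (E := Real.exp ε₀) (S := 1.41422) (t := 1 / 100)
    (T₁ := 1010051 / 1000000) (T₂ := 510101 / 500000)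
    hβ0 hβ (by norm_num) (by norm_num) hκ le_rfl sqrt_two_le exp_le_1_100_w
    (by rw [show (2:ℝ) * (1 / 100) = 1 / 50 by norm_num]; exact exp_le_1_50_w)
    hc (by norm_num) (by norm_num) (by unfold doorPoly; norm_num) (by unfold gaugeR Delta; norm_num)
  have e2 : (2 : ℝ) * (1 / 100) = 1 / 50 := by norm_num
  rw [e2] at h
  have hhalf : βW / 2 = (1 / 500) / (Real.exp ε₀ * (1 + 2 * (1.41422 : ℝ) * (1 / 3))) := by
    rw [hβW]; ring
  exact h β hβ0' (by rw [hhalf]; exact hβle)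

/-- g4's **HAAR BASIN proper** (`β = 0`, verbatim): every `κ ≥ 1/100`, every `ε₀ ≥ 0`, Lipschitz load `1/3`. -/
theorem su2_torusClusteringOnBallW_star_haar_t100 :
    ∀ κ : ℝ, 1 / 100 ≤ κ → ∀ ε₀ : ℝ, 0 ≤ ε₀ →
      TorusClusteringOnBallW 2 4 0 κ ε₀ (1 / 3) (16 * Real.exp (1 / 50)) (1 / 100) :=
  fun κ hκ ε₀ hε₀ => su2_torusClusteringOnBallW_star_haarSliver_t100 κ hκ ε₀ hε₀ 0 le_rfl (by positivity)

/-- ★ **THE HAAR BASIN IN BAŁABAN'S CURRENCY: ONE INEQUALITY.**  At effective coupling `0` (the Haar form of the action, g4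
§4c), a perturbation in strip format `(r, κ, η)` with thin supports and `κ ≥ 1/100 + δ` clusters at `(16 e^{1/50}, 1/100)` on every
torus `L ≥ 3` as soon as `8η/(e·δ·r) ≤ 1/3`, i.e. `η ≤ e·δ·r/24 ≈ 0.1133·δ·r` — nothing is asked of the oscillation axis. -/
theorem su2_clustersWith_of_strip_haar (hL : 3 ≤ L) (W : Perturbation 4 L 2) {r κ η δ : ℝ} (hr : 0 < r)
    (hW : W.HasAnalyticNormLE (fundamentalRep (Fin 2)) (fun _ => stripDomain (fundamentalRep (Fin 2)) r) κ η)
    (hsupp : ∀ X, W.act X ≠ 0 → (polymerDiam X : ℝ) ≤ (X.card : ℝ) - 1)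
    (hδ : 0 < δ) (hκ : 1 / 100 + δ ≤ κ) (h₁ : 8 / (Real.exp 1 * δ * r) * η ≤ 1 / 3) :
    ClustersWith W 0 (16 * Real.exp (1 / 50)) (1 / 100) := by
  have hη := eta_nonneg_of_hasAnalyticNormLE_strip W hr hW
  have h₁' : 2 * ((4 : ℕ) : ℝ) / (Real.exp 1 * δ * r) * η ≤ 1 / 3 := by
    have e : (2 : ℝ) * ((4 : ℕ) : ℝ) = 8 := by norm_num
    rw [e]; exact h₁
  exact clustersWith_of_strip (su2_torusClusteringOnBallW_star_haar_t100 (1 / 100) le_rfl (2 * η) (by positivity)) hL W hr hW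
    hsupp (by norm_num) hδ hκ le_rfl h₁'


end Summit.Ventures.YMGap.YM4Door

end
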